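import Summits.BirchSwinnertonDyer.BirchSwinnertonDyer.Theorems.ThetaPartnerAtTwoSignedKatoUpToAtTwoLayerPairingCompat
import Summits.BirchSwinnertonDyer.BirchSwinnertonDyer.Theorems.ThetaPartnerAtTwoSignedKatoUpToAtTwoLayerPairingLiterature
import Literature.NumberTheory.EllipticCurves.Kato2004.IwasawaH1ReductionSurjectiveProofs
import HarnessLib

/-!
# Route `ThetaPartnerAtTwo` (TP2), crux K2R0P♭ `SignedMainConjectureCMTwoRankZeroOfPubOfFlat` (stmt-BirchSwinnertonDyer-26471;
# derived node K2r0P stmt-BirchSwinnertonDyer-24945), line `rankzero` v19, stub `stub_poitouTateDeepTwoGen` = (S_PT) — the two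
# COMPATIBILITIES (C) of the assembly `SignedLowerOffTwo.PTDeep.poitouTateDeep_of_levelwise` (brick B9), DISCHARGED for THE Weil tower:
# level compatibility in `k` of the finite-coefficient layer pairings on FINITE-LEVEL classes (`p_* = WeierstrassCurve.reduceTorsionH1`),
# and the projection formula in `n` — both read in the Literature names `CyclotomicLayer.layerPairingMod` / `CyclotomicLayer.weilTowerPk`

HONEST FRAMING (cell `pub/bsd-wall`, W-ALL row 1; lead prover `bsd-wall-tp2-p2` g10, `--supports` only). THEOREMS ONLY (no definition,
no named fact, no instance, no `sorry`); closes no item; BSD is NOT proved by any of this.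

## What is here

* `cohomologyMap_torsionPow_eq_reduceTorsionH1` — the K3 column's transition map `[p]_* = cohomologyMap (subgroupRepMap (torsionPow W k) U) 1`
  (`…LayerPairingCompat`, `ℕ`-cast index) IS the tree's `WeierstrassCurve.reduceTorsionH1 p k U` (`HeegnerModuleIndex`, the transition map
  of Perrin-Riou's compact Selmer group and of `Kato2004.IwasawaH1TowerLimitProofs`): same map on cocycles.
* `layerPairingMod_reduceTorsionH1` — **(C)_k on finite-level classes**: `⟨y, Q⟩_{n,p^{k+1}} mod p^k = ⟨p_* y, Q⟩_{n,p^k}` for every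
  `y ∈ H¹(Γ_n, W[p^{k+1}])`, `Q ∈ E(ℚ_{n,v})` (the six commuting squares (2)–(6) of `SignedKatoOffTwo.LayerPairing.layerPairingPk_succ_compat`,
  without square (1) — i.e. before composing with `red_{p^k}`; Weil tower compatibility = Silverman III.8.1 (e), `weilTowerPk_torsionPow`).
* `layerPairingMod_layerCores_lit` — **(C)_n**: `⟨Cor y, Q⟩_{n,N} = ⟨y, Q⟩_{n+1,N}` for `Q ∈ E(ℚ_{n,v})`, cyclotomic `κ`, `v ∣ p`
  (`SignedKatoOffTwo.LayerPairing.layerPairingMod_layerCores` through the `rfl` bridge `layerPairingMod_eq_cyclotomicLayer`).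
These are exactly the hypotheses `hpk` / `hpn` of `poitouTateDeep_of_levelwise` for THE Weil tower `CyclotomicLayer.weilTowerPk`.

References: [Kobayashi2003] (8.23) (p. 18); [PerrinRiou1994Invent] §3.6.1; [SilvermanAEC2009] III.8.1 (e); [Kato2004Asterisque] §13.8;
[NeukirchSchmidtWingberg2008] I §5 (1.5.3) (iv).
-/

set_option autoImplicit false
-- the Theorems namespace of this sub repeats the summit name by design (D-0017 nested layout)
set_option linter.dupNamespace false

noncomputable section

open scoped Classical

namespace Summit.BirchSwinnertonDyer.BirchSwinnertonDyer.Theorems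

namespace SignedLowerOffTwo.PTDeep

open CategoryTheory NumberField IsDedekindDomain Field WeierstrassCurve
  Literature.NumberTheory.EllipticCurves Literature.NumberTheory.EllipticCurves.Kobayashi2003
  Literature.NumberTheory.EllipticCurves.Sprung2012 Literature.NumberTheory.GaloisRepresentations
  Literature.NumberTheory.GaloisCohomology
  Literature.NumberTheory.EllipticCurves.Kato2004 Literature.NumberTheory.EllipticCurves.Kato2004.EulerSystemValues ZpExtension
  SignedKatoOffTwo.LayerPairing

attribute [local instance] absoluteGaloisGroup_compactSpace

variable (W : WeierstrassCurve ℚ) [W.IsElliptic] {p : ℕ} [Fact p.Prime] (κ : ZpExtension ℚ p) (v : HeightOneSpectrum (𝓞 ℚ))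

omit [W.IsElliptic] [Fact p.Prime] in
/-- The K3 column's `[p]_* : H¹(U, W[p^{k+1}]) → H¹(U, W[p^k])` (`cohomologyMap` along `torsionPow`, `ℕ`-cast index) IS
`WeierstrassCurve.reduceTorsionH1 p k U` (same map `[φ] ↦ [p • φ]` on cocycles; the indices `((p^j : ℕ) : ℤ)` and `(p : ℤ)^j` agree
definitionally). [cite: PerrinRiou1987BSMF, §0 (p. 401)] [cite: SerreGaloisCohomology1997, I §2.2] -/
theorem cohomologyMap_torsionPow_eq_reduceTorsionH1 (k : ℕ) (U : Subgroup (absoluteGaloisGroup ℚ))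
    (y : H1 (W.torsionGaloisModule ((p ^ (k + 1) : ℕ) : ℤ)) U) :
    cohomologyMap (subgroupRepMap (torsionPow W k) U) 1 y = W.reduceTorsionH1 p k U y := by
  obtain ⟨φ, rfl⟩ := oneCocycleClass_surjective _ y
  rw [cohomologyMap_oneCocycleClass]
  refine Eq.trans ?_ (reduceTorsionH1_oneCocycleClass W p k U φ).symm
  congr 1

/-- **(C)_k — level compatibility of the finite-coefficient layer pairings on FINITE-LEVEL classes**: for `y ∈ H¹(Γ_n, W[p^{k+1}])`
and `Q ∈ E(ℚ_{n,v})`, `⟨y, Q⟩_{n,p^{k+1}} mod p^k = ⟨p_* y, Q⟩_{n,p^k}` (THE Weil tower; squares (2) localisation, (3) Shapiro, (4) Kummer,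
(5) summed Weil cup products, (6) invariant maps of `layerPairingPk_succ_compat`). The hypothesis `hpk` of `poitouTateDeep_of_levelwise`.
[cite: SilvermanAEC2009, Prop. III.8.1 (e)] [cite: Kobayashi2003, (8.23) (p. 18)] [cite: PerrinRiou1994Invent, §3.6.1] -/
theorem layerPairingMod_reduceTorsionH1 (n k : ℕ) (y : W.torsionH1Over ((p : ℤ) ^ (k + 1)) (κ.layerSubgroup n))
    (Q : localLayerPointsOfEmb κ (closureEmb (K := ℚ) (v.adicCompletion ℚ)) W n) :
    (ZMod.cast (CyclotomicLayer.layerPairingMod W (p ^ (k + 1)) (CyclotomicLayer.weilTowerPk W (k + 1))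
        (CyclotomicLayer.weilTowerPk_pow W (k + 1)) (CyclotomicLayer.weilTowerPk_add_left W (k + 1))
        (CyclotomicLayer.weilTowerPk_add_right W (k + 1)) (CyclotomicLayer.weilTowerPk_smul W (k + 1)) κ v n y Q) :
        ZMod (p ^ k)) =
      CyclotomicLayer.layerPairingMod W (p ^ k) (CyclotomicLayer.weilTowerPk W k) (CyclotomicLayer.weilTowerPk_pow W k)
        (CyclotomicLayer.weilTowerPk_add_left W k) (CyclotomicLayer.weilTowerPk_add_right W k)
        (CyclotomicLayer.weilTowerPk_smul W k) κ v n (W.reduceTorsionH1 p k (κ.layerSubgroup n) y) Q := by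
  -- the statement in the K3 column's (Summits-side) names, with its `[p]_*`
  have h : (ZMod.cast (layerPairingMod W (p ^ (k + 1)) (weilTowerPk W (k + 1)) (weilTowerPk_pow W (k + 1))
      (weilTowerPk_add_left W (k + 1)) (weilTowerPk_add_right W (k + 1)) (weilTowerPk_smul W (k + 1)) κ v n y Q) :
        ZMod (p ^ k)) =
      layerPairingMod W (p ^ k) (weilTowerPk W k) (weilTowerPk_pow W k) (weilTowerPk_add_left W k)
        (weilTowerPk_add_right W k) (weilTowerPk_smul W k) κ v n
        (cohomologyMap (subgroupRepMap (torsionPow W k) (κ.layerSubgroup n)) 1 y) Q := by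
    have hcast : ∀ z : ZMod (p ^ (k + 1)), (ZMod.cast z : ZMod (p ^ k)) =
        ZMod.castHom (Dvd.intro p (pow_mul_prime_eq k)) (ZMod (p ^ k)) z := fun z ↦ rfl
    rw [hcast, layerPairingMod_apply, layerPairingMod_apply, ← invAt_cohomologyMap_muLocalPow v k,
      cupProduct_layerSumPairing_succ W κ v k (weilTowerPk W) (weilTowerPk_pow W) (weilTowerPk_add_left W)
        (weilTowerPk_add_right W) (weilTowerPk_smul W) (weilTowerPk_torsionPow W) n]
    unfold layerShapiro
    rw [← shapiroLift_cohomologyMap, ← shapiroLift_cohomologyMap, ← layerLoc_cohomologyMap_torsionPow,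
      cohomologyMap_torsionLocalPow_layerKummer]
  rw [cohomologyMap_torsionPow_eq_reduceTorsionH1] at h
  exact h

variable (hκ : κ.IsCyclotomic) (hv : (p : 𝓞 ℚ) ∈ v.asIdeal)

include hκ hv in
/-- **(C)_n — the projection formula across layers, modulo `p^k`, in Literature names**: `⟨Cor y, Q⟩_{n,p^k} = ⟨y, Q⟩_{n+1,p^k}` for
`Q ∈ E(ℚ_{n,v}) ⊆ E(ℚ_{n+1,v})`, the cyclotomic `ℤ_p`-tower at `v ∣ p` (`SignedKatoOffTwo.LayerPairing.layerPairingMod_layerCores` through the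
`rfl` bridge). The hypothesis `hpn` of `poitouTateDeep_of_levelwise`. [cite: Kobayashi2003, (8.23) (p. 18)]
[cite: NeukirchSchmidtWingberg2008, I §5 Prop. (1.5.3) (iv)] -/
theorem layerPairingMod_layerCores_lit (n k : ℕ) (c : W.torsionH1Over ((p : ℤ) ^ k) (κ.layerSubgroup (n + 1)))
    (Q : localPoints W (v.adicCompletion ℚ)) (hQ : Q ∈ localLayerPointsOfEmb κ (closureEmb (K := ℚ) (v.adicCompletion ℚ)) W n) :
    CyclotomicLayer.layerPairingMod W (p ^ k) (CyclotomicLayer.weilTowerPk W k) (CyclotomicLayer.weilTowerPk_pow W k)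
        (CyclotomicLayer.weilTowerPk_add_left W k) (CyclotomicLayer.weilTowerPk_add_right W k)
        (CyclotomicLayer.weilTowerPk_smul W k) κ v n (layerCores (W.torsionGaloisModule ((p : ℤ) ^ k)) κ n c) ⟨Q, hQ⟩ =
      CyclotomicLayer.layerPairingMod W (p ^ k) (CyclotomicLayer.weilTowerPk W k) (CyclotomicLayer.weilTowerPk_pow W k)
        (CyclotomicLayer.weilTowerPk_add_left W k) (CyclotomicLayer.weilTowerPk_add_right W k)
        (CyclotomicLayer.weilTowerPk_smul W k) κ v (n + 1) c
        ⟨Q, localLayerPointsOfEmb_mono κ (closureEmb (K := ℚ) (v.adicCompletion ℚ)) W (Nat.le_succ n) hQ⟩ := by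
  exact layerPairingMod_layerCores W (p ^ k) (weilTowerPk W k) (weilTowerPk_pow W k) (weilTowerPk_add_left W k)
    (weilTowerPk_add_right W k) (weilTowerPk_smul W k) κ v hκ hv n c Q hQ

end SignedLowerOffTwo.PTDeep

end Summit.BirchSwinnertonDyer.BirchSwinnertonDyer.Theorems

end
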